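import Mathlib
import Summits.ResolutionOfSingularities.ResolutionOfSingularities.Theorems.WeightedInvariantLocalWeightedDropNCResCurveGraphLoop
import Summits.ResolutionOfSingularities.ResolutionOfSingularities.Theorems.WeightedInvariantLocalWeightedDropNCResCurveGraphEntry
import Summits.ResolutionOfSingularities.ResolutionOfSingularities.Theorems.WeightedInvariantLocalWeightedDropTOT2E1Decorated
import Summits.ResolutionOfSingularities.ResolutionOfSingularities.Theorems.WeightedInvariantLocalWeightedDropNCResRegimeDefs

/-!
# `WeightedInvariant.LocalWeightedDrop`: NC-RESOLUTION SETTINGS for the TOT₂ line (S-SET), part 18 — THE REGIME «APEX DIMENSION ≤ 1» CLOSED: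
# from every admissibly decorated position with `o ≥ 2` whose product has apex dimension ≤ 1 the mover forces a head drop

Crux item stmt-ResolutionOfSingularities-8899 `LocalWeightedDrop` (route `ResolutionOfSingularities/WeightedInvariant`), ENGINE skeleton v32,
residual `stub_spaceNCRankDrop`; TOT2-LINE v1.3 (res-L1-w43-lead-1 g5) inner dispatch: the regime `HCol` (rank 0) of `regime_split`.
[OURS · L1 W4.3 · chain w43 · seat res-L1-w43-stub-1 gen 6; def-free; composes res-type-056's S-E1 (`TOT2E1.dWinsTo_headDrop_of_isolated`) and
entry lemma (`…NCResCurveGraphEntry`) with parts 12 (E0) and 17 (the graph-curve loop); nothing here is a statement of any manuscript; AI-produced,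
gate-checked, weaker than expert review.]

* **`dWinsTo_headDrop_of_hCol`** — `Admissible b δ → 2 ≤ δ.o → (every two invariance vectors of in_c(f·∏_O x_l) are dependent) →
  DWinsTo Prod.fst (fun τ => Admissible τ.1 τ.2 ∧ τ.2.head < δ.head) (b, δ)` (`m ≥ 1`, `k` infinite): apex trivial ⇒ E0; else isolated (HISOL) ⇒
  S-E1; else some legal `Φ` makes the last axis permissible ⇒ a permissible GRAPH curve ⇒ the loop of part 17.
-/

set_option linter.dupNamespace false -- mandated namespace of this single-conjunct summit

noncomputable section

namespace Summit.ResolutionOfSingularities.ResolutionOfSingularities.Theorems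

namespace TameFourTupleDrop

namespace GraphCurve

open MvPowerSeries Literature.AlgebraicGeometry.Resolution

variable {k : Type} [Field k] {m : ℕ}

-- BODY-START
/-- **THE REGIME «APEX DIMENSION ≤ 1» IS WON** (OURS · L1 W4.3; TOT2-LINE inner dispatch, regime `HCol`): from every admissibly decorated position
with `o ≥ 2` whose product `g = f·∏_{l∈O} x_l` (order `c = o + |O|`) has at most a line of invariance vectors in its degree-`c` form, the mover
forces an admissibly decorated position of strictly smaller head `(o, c)`.  Three sub-regimes: no invariance vector (E0: the identity point move has
no near point — part 12); a line of them and NO permissible smooth curve (res-type-056's S-E1: prepared axis presentations, the fundamental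
sequence is finite); a line of them and SOME permissible smooth curve (res-type-056's entry lemma re-presents it as a graph curve; part 17's loop:
finitely many identity point moves lower the contact potential with the boundary letters, then the curve move has no near point). -/
theorem dWinsTo_headDrop_of_hCol [Infinite k] (hm : 0 < m) {b : MvPowerSeries (Fin (m + 1)) k} {δ : Decoration k m}
    (hadm : Admissible b δ) (ho : 2 ≤ δ.o)
    (hcol : ∀ u₁ u₂ : Fin (m + 1) → k,
      (∀ v, CobordantChart.initEval (fun _ : Fin (m + 1) => 1) (v + u₁) δ.c (δ.f * ∏ l ∈ δ.O, X l) =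
        CobordantChart.initEval (fun _ : Fin (m + 1) => 1) v δ.c (δ.f * ∏ l ∈ δ.O, X l)) →
      (∀ v, CobordantChart.initEval (fun _ : Fin (m + 1) => 1) (v + u₂) δ.c (δ.f * ∏ l ∈ δ.O, X l) =
        CobordantChart.initEval (fun _ : Fin (m + 1) => 1) v δ.c (δ.f * ∏ l ∈ δ.O, X l)) →
      ∃ α β : k, (α ≠ 0 ∨ β ≠ 0) ∧ α • u₁ + β • u₂ = 0) :
    DWinsTo (St := MvPowerSeries (Fin (m + 1)) k × Decoration k m) Prod.fst
      (fun τ => Admissible τ.1 τ.2 ∧ τ.2.head < δ.head) (b, δ) := by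
  by_cases hapex : ∀ u : Fin (m + 1) → k,
      (∀ v, CobordantChart.initEval (fun _ : Fin (m + 1) => 1) (v + u) δ.c (δ.f * ∏ l ∈ δ.O, X l) =
        CobordantChart.initEval (fun _ : Fin (m + 1) => 1) v δ.c (δ.f * ∏ l ∈ δ.O, X l)) → u = 0
  · -- E0: no invariance vector
    exact dWinsTo_headDrop_of_apexTrivial hadm hapex
  · push Not at hapex
    obtain ⟨v₀, hv₀, hv₀ne⟩ := hapex
    have hone : ∃ v : Fin (m + 1) → k, v ≠ 0 ∧ ∀ x : Fin (m + 1) → k,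
        CobordantChart.initEval (fun _ : Fin (m + 1) => 1) (x + v) δ.c (δ.f * ∏ l ∈ δ.O, X l) =
          CobordantChart.initEval (fun _ : Fin (m + 1) => 1) x δ.c (δ.f * ∏ l ∈ δ.O, X l) := ⟨v₀, hv₀ne, hv₀⟩
    by_cases hisol : ∀ Φ : Fin (m + 1) → MvPowerSeries (Fin (m + 1)) k, (∀ l, constantCoeff (Φ l) = 0) →
        IsUnit (Matrix.det (Matrix.of fun a j : Fin (m + 1) => coeff (Finsupp.single j 1) (Φ a))) →
        ¬ AxisPolyhedron.InAxisIdeal δ.c (subst Φ (δ.f * ∏ l ∈ δ.O, X l))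
    · -- S-E1: isolated (res-type-056)
      exact TOT2E1.dWinsTo_headDrop_of_isolated hadm ho hone hcol hisol
    · -- S-E1-CURVE: on a permissible curve
      push Not at hisol
      obtain ⟨Φ, hΦ0, hΦdet, hin⟩ := hisol
      obtain ⟨i, φ, hφ0, -, hperm⟩ := exists_shear_inOffIdeal_of_legal_inAxisIdeal hΦ0 hΦdet hin
      exact dWinsTo_headDrop_of_graphCurve hm hadm (fun j _ => hφ0 j) hperm hcol
end GraphCurve

/-- **REGIME (H) OF TOT2-LINE v1.3 IN `Decoration.HCol` FORM** (res-L1-w43-lead-1's `…NCResRegimeDefs`): the apex-column regime is won. -/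
theorem Decoration.dWinsTo_headDrop_of_hCol {k : Type} [Field k] {m : ℕ} [Infinite k] (hm : 0 < m)
    {b : MvPowerSeries (Fin (m + 1)) k} {δ : Decoration k m}
    (hadm : Admissible b δ) (ho : 2 ≤ δ.o) (hcol : δ.HCol) :
    DWinsTo (St := MvPowerSeries (Fin (m + 1)) k × Decoration k m) Prod.fst
      (fun τ => Admissible τ.1 τ.2 ∧ τ.2.head < δ.head) (b, δ) :=
  GraphCurve.dWinsTo_headDrop_of_hCol hm hadm ho hcol

end TameFourTupleDrop

/-- **REGISTERED STUB (skeleton v33) `stub_regimeApexColumn` — REGIME (H), THE APEX COLUMN `e^O ≤ 1`, PROVED** (OURS · L1 W4.3; TOT2-LINE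
v1.3, res-L1-w43-lead-1 g5): three letters, `k` algebraically closed of characteristic `p`; from every admissibly decorated position with `2 ≤ o`
in the apex column the mover forces an admissibly decorated position of strictly smaller head.  `:= TameFourTupleDrop.GraphCurve.dWinsTo_headDrop_of_hCol`
(E0 — S-E1 (res-type-056) — S-E1-CURVE). -/
theorem stub_regimeApexColumn : ∀ (p : ℕ), p.Prime → ∀ (k : Type) [Field k] [CharP k p] [IsAlgClosed k],
    ∀ (b : MvPowerSeries (Fin 3) k) (δ : TameFourTupleDrop.Decoration k 2), TameFourTupleDrop.Admissible b δ → 2 ≤ δ.o → δ.HCol →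
      TameFourTupleDrop.DWinsTo (St := MvPowerSeries (Fin 3) k × TameFourTupleDrop.Decoration k 2) Prod.fst
        (fun τ => TameFourTupleDrop.Admissible τ.1 τ.2 ∧ τ.2.head < δ.head) (b, δ) :=
  fun _ _ _ _ _ _ _ _ hadm ho hcol => TameFourTupleDrop.GraphCurve.dWinsTo_headDrop_of_hCol Nat.two_pos hadm ho hcol
-- BODY-END

end Summit.ResolutionOfSingularities.ResolutionOfSingularities.Theorems

end
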